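import Summits.ResolutionOfSingularities.ResolutionOfSingularities.Theorems.HomologicalConductorNoZenoNodeCurveRegular
import Summits.ResolutionOfSingularities.ResolutionOfSingularities.Theorems.HomologicalConductorNoZenoFiniteCentreBlowup
import HarnessLib

/-!
# Crux `NoZenoR` (stmt-ResolutionOfSingularities-19943), slot 5 `stub_L1wCoreF3`, seam2 ROUTE M — (n3-up):
# the node curves of the blow-up of a FINITE centre are regular curves (order-one form `¬ (𝓘_n)_w ≤ 𝔪_w²`)

OURS (cell res-hironaka, chain W4.4; stub worker res-L0-w44-stub-4 g8; object (n3-up) of the lead seat res-L0-w44-lead-1's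
PRECISION 21:29:15Z / naming 21:30:17Z).  Nothing here is a statement of the manuscript under review (Hironaka 2017);
AI-written, weaker than expert review; def-free, fact-free.  A two-line composition of res-L0-w44-stub-1's one-point NODE
statements (`…NoZenoNodeCurveRegular`: `PointBlowup.exists_primeDivisorIdeal_eq_comap_vanishingIdeal_node`,
`PointBlowup.not_stalkIdeal_primeDivisorIdeal_le_sq_node`, for a centre `Z` isolated at `x` by an open `U`) with
res-L1-type-o5's FINITE-CENTRE currency (`…NoZenoFiniteCentreBlowup`: `N` a finite set of closed points lying on
exceptional curves, `ρ` the blow-up of `vanishingIdeal N`, node curves `n_z` with `ρ⁻¹{z} = closure {n_z}`).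

* `isOpen_compl_diff_singleton` / `inter_compl_diff_singleton` — the open `U := (N ∖ {z})ᶜ` isolates `z` in `N`;
* `eq_of_closure_singleton_eq` — `closure {a} = closure {b} → a = b` on a scheme;
* `primeDivisorIdeal_eq_comap_vanishingIdeal_singleton` — for `z ∈ N` and `ρ⁻¹{z} = closure {n}`:
  `𝓘_n = 𝓘_{z} · 𝒪_(X¹)` (the prime divisor ideal of the node curve is the pulled-back point ideal);
* **`not_stalkIdeal_primeDivisorIdeal_le_sq_finiteCentre`** — `∀ z ∈ N, ∀ w, n_z ⤳ w → ¬ (𝓘_{n_z})_w ≤ 𝔪_w²`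
  (`X` regular locally Noetherian; the `hreg` input of the lead's `hasSplitExcCurveCountLE_pred_routeM` for the NEW curves
  of the upstairs node blow-up `ρ_f`, centre `σ⁻¹(sepNodes π)`).

References: Q. Liu, *Algebraic Geometry and Arithmetic Curves* (2002), Thm. 8.1.19 [`Liu2002`]; H. Matsumura,
*Commutative Ring Theory*, Thm. 14.2 [`Matsumura1987`].
-/

noncomputable section

-- single-problem summit: the doubled namespace component `ResolutionOfSingularities` is forced
set_option linter.dupNamespace false

namespace Summit.ResolutionOfSingularities.ResolutionOfSingularities.Theorems.NoZeno.ExcCount.FiniteCentreBlowup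

open CategoryTheory AlgebraicGeometry TopologicalSpace Topology IsLocalRing
open Literature.AlgebraicGeometry.Resolution Scheme.IdealSheafData

/-! ## Isolating one point of a finite set of closed points -/

/-- The complement of `N ∖ {z}` is open when `N` is a finite set of closed points. [folklore] -/
theorem isOpen_compl_diff_singleton {X : Scheme.{0}} {N : Set X} (hNfin : N.Finite)
    (hNcl : ∀ z ∈ N, IsClosed ({z} : Set X)) (z : X) : IsOpen (N \ {z})ᶜ := by
  have hc : IsClosed (N \ {z}) := by
    rw [← Set.biUnion_of_singleton (N \ {z})]
    exact (hNfin.subset Set.sdiff_subset).isClosed_biUnion fun y hy => hNcl y hy.1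
  exact hc.isOpen_compl

/-- `N ∩ (N ∖ {z})ᶜ = {z}` for `z ∈ N`. [folklore] -/
theorem inter_compl_diff_singleton {X : Scheme.{0}} {N : Set X} {z : X} (hz : z ∈ N) : N ∩ (N \ {z})ᶜ = {z} := by
  ext y
  constructor
  · rintro ⟨hyN, hyc⟩
    by_contra hne
    exact hyc ⟨hyN, hne⟩
  · intro h
    rw [Set.mem_singleton_iff] at h
    subst h
    exact ⟨hz, fun h => h.2 rfl⟩

/-- On a scheme (a T₀ space) a point is determined by its closure. [folklore] -/
theorem eq_of_closure_singleton_eq {X : Scheme.{0}} {a b : X} (h : closure ({a} : Set X) = closure {b}) : a = b :=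
  (inseparable_iff_closure_eq.mpr h).eq

/-! ## The node curves of a finite-centre blow-up -/

section NodeCurves

variable {S : Type} [CommRing S] [IsLocalRing S] {X X1 : Scheme.{0}}
  [IsLocallyNoetherian X] [IsLocallyNoetherian X1]
  (π : X ⟶ Spec (.of S)) {ρ : X1 ⟶ X} {N : Set X} (hNc : IsClosed N) (hNfin : N.Finite)
  (hNcl : ∀ z ∈ N, IsClosed ({z} : Set X))
  (hNexc : ∀ z ∈ N, ∃ η ∈ excCurvePoints π, η ⤳ z ∧ z ≠ η)

omit [IsLocallyNoetherian X1] in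
include hNfin hNcl hNexc in
/-- **The prime divisor ideal of a node curve is the pulled-back point ideal**: for the blow-up `ρ : X¹ → X` of the finite
centre `N` (`X` regular), `z ∈ N` and `n` with `ρ⁻¹{z} = closure {n}`: `𝓘_n = 𝓘_{z}·𝒪_(X¹)` (res-L0-w44-stub-1's one-point node
statement on the open `(N ∖ {z})ᶜ` isolating `z`). [cite: Liu2002, Thm. 8.1.19] -/
theorem primeDivisorIdeal_eq_comap_vanishingIdeal_singleton (hX : Scheme.IsRegular X)
    (hρ : IsBlowup ρ (vanishingIdeal ⟨N, hNc⟩)) {z : X} (hz : z ∈ N) {n : X1} (hfib : ρ.base ⁻¹' {z} = closure {n}) :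
    primeDivisorIdeal n = (vanishingIdeal ⟨{z}, hNcl z hz⟩).comap ρ := by
  obtain ⟨η, hηcl, hη⟩ := PointBlowup.exists_primeDivisorIdeal_eq_comap_vanishingIdeal_node hX ⟨N, hNc⟩ hρ z
    (hNcl z hz) ⟨(N \ {z})ᶜ, isOpen_compl_diff_singleton hNfin hNcl z⟩ (by simp [hz]) (inter_compl_diff_singleton hz)
    (maximalIdeal_stalk_ne_bot π hNexc hz)
  rw [← eq_of_closure_singleton_eq (hηcl.trans hfib), hη]

include hNfin hNcl hNexc in
/-- **(n3-up) THE NODE CURVES OF A FINITE-CENTRE BLOW-UP ARE REGULAR CURVES** (order-one form): for the blow-up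
`ρ : X¹ → X` of the finite centre `N` of closed points on the exceptional curves (`X` regular locally Noetherian), every
`z ∈ N` and `n` with `ρ⁻¹{z} = closure {n}`, and every point `w` of the node curve `closure {n}`:
`¬ (𝓘_n)_w ≤ 𝔪_w ^ 2` — the `hreg` clause of the lead's ROUTE M count drop for the new curves, in res-L1-type-o5's
`FiniteCentreBlowup` currency (upstairs centre `σ⁻¹(sepNodes π)`). [cite: Liu2002, Thm. 8.1.19] -/
theorem not_stalkIdeal_primeDivisorIdeal_le_sq_finiteCentre (hX : Scheme.IsRegular X)
    (hρ : IsBlowup ρ (vanishingIdeal ⟨N, hNc⟩)) {z : X} (hz : z ∈ N) {n : X1} (hfib : ρ.base ⁻¹' {z} = closure {n})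
    {w : X1} (hw : n ⤳ w) : ¬ stalkIdeal (primeDivisorIdeal n) w ≤ maximalIdeal (X1.presheaf.stalk w) ^ 2 :=
  PointBlowup.not_stalkIdeal_primeDivisorIdeal_le_sq_node hX ⟨N, hNc⟩ hρ z (hNcl z hz)
    ⟨(N \ {z})ᶜ, isOpen_compl_diff_singleton hNfin hNcl z⟩ (by simp [hz]) (inter_compl_diff_singleton hz)
    (primeDivisorIdeal_eq_comap_vanishingIdeal_singleton π hNc hNfin hNcl hNexc hX hρ hz hfib) hw

include hNfin hNcl hNexc in
/-- The same for ALL node curves at once, with `n_z` read off res-L1-type-o5's `exists_curve_fibre_eq_closure` clause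
`hcurve : ∀ z ∈ N, ∃ n ∈ excCurvePoints (ρ ≫ π), ρ⁻¹{z} = closure {n}`: every NEW exceptional curve `n` of `ρ ≫ π`
(`ρ n ∈ N`) satisfies `∀ w, n ⤳ w → ¬ (𝓘_n)_w ≤ 𝔪_w²`. [this work] -/
theorem forall_new_not_stalkIdeal_primeDivisorIdeal_le_sq (hX : Scheme.IsRegular X)
    (hρ : IsBlowup ρ (vanishingIdeal ⟨N, hNc⟩))
    (hcurve : ∀ z ∈ N, ∃ n ∈ excCurvePoints (ρ ≫ π), ρ.base ⁻¹' {z} = closure {n})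
    {n : X1} (hn : n ∈ excCurvePoints (ρ ≫ π)) (hnN : ρ.base n ∈ N) {w : X1} (hw : n ⤳ w) :
    ¬ stalkIdeal (primeDivisorIdeal n) w ≤ maximalIdeal (X1.presheaf.stalk w) ^ 2 :=
  not_stalkIdeal_primeDivisorIdeal_le_sq_finiteCentre π hNc hNfin hNcl hNexc hX hρ hnN
    (preimage_singleton_eq_closure π ρ hcurve hn hnN) hw

end NodeCurves

end Summit.ResolutionOfSingularities.ResolutionOfSingularities.Theorems.NoZeno.ExcCount.FiniteCentreBlowup

end
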